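import Literature.NumberTheory.Automorphic.BianchiCuspCoordinates
import Literature.NumberTheory.Automorphic.BianchiDirichlet
import Mathlib.Topology.MetricSpace.ProperSpace
import HarnessLib

/-!
# Cusp classes and a compact fundamental set for the thick part of the cone under a Bianchi group

Topic `NumberTheory/Automorphic`; namespace `Literature.NumberTheory.Automorphic`, grouping
sub-namespace `BianchiCusp`.  Theorems only (no definition, no `sorry`).

CUSP CLASSES.  The cusp equivalence `v ~ w :⟺ x v = y (γ w)` (`CuspRel` of
`BianchiCuspCoordinates`; `γ ∈ GL₂(𝓞_K)`, `x, y ∈ 𝓞_K ∖ 0`) is an equivalence relation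
(`CuspRel.refl/symm/trans`), only `0` is equivalent to `0`, and one may choose finitely many
representatives of the non-zero vectors that are PAIRWISE INEQUIVALENT — one per cusp of
`GL₂(𝓞_K)` (`exists_inequivalent_representatives`, from `exists_reduced_representatives` of
`BianchiCuspIdealClasses`; [ElstrodtGrunewaldMennicke1998, Ch. 7 §7.2 Thm. 2.4]); parallel vectors
are equivalent (`cuspRel_of_det2_eq_zero`).

Reduction theory of `Γ = GL₂(𝓞_K)` (`K` imaginary quadratic) on the cone `𝒫` of positive
definite binary Hermitian forms, THICK PART: a form `H` is thick if every cusp has depth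
`≥ 1` at `H` (it lies outside all the horoball cones of parameter `1`).  We prove
([ElstrodtGrunewaldMennicke1998, Ch. 7 §7.3, Thm. 3.4 / the compactness of the truncated
fundamental domain]; [Swan1971, §3–§4]; [BorelSerre1973, §11 for the general statement]):

* `exists_compact_fundamental` — **there is a compact `F ⊆ 𝒫` such that every thick `H` is
  `Γ`-equivalent, up to a positive scalar, to a point of `F`**: by Dirichlet
  (`exists_depth_le`) some cusp has depth `≤ C` at `H`; move it to one of the finitely many
  representatives `u` (`exists_inequivalent_representatives`), so that `1 ≤ depth_u ≤ C`;
  translate the horizontal coordinate into the disc of radius `ρ` (`hcoord_act_transl`,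
  covering radius of `σ(𝓞_K)`); in the cusp coordinates the normalised form is then
  `(p z; z̄ (1+|z|²)/p)` with `p ∈ [N𝔞_u, C N𝔞_u]`, `|z| ≤ ρ C N𝔞_u` (`paramForm` of
  `BianchiCuspCoordinates`), a compact family.

## References

* J. Elstrodt, F. Grunewald, J. Mennicke, *Groups Acting on Hyperbolic Space* (1998), Ch. 7
  §7.3 [ElstrodtGrunewaldMennicke1998].
* R. G. Swan, Adv. Math. 6 (1971), §3–§4 [Swan1971].
* A. Borel, J.-P. Serre, Comment. Math. Helv. 48 (1973), §11 [BorelSerre1973].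
-/

noncomputable section

open Matrix Complex NumberField
open scoped MatrixGroups ComplexConjugate

namespace Literature.NumberTheory.Automorphic

namespace BianchiCusp

open BianchiCone Literature.NumberTheory.NumberFields

variable {K : Type*} [Field K] [NumberField K] (σ : K →+* ℂ)

/-! ### Cusp equivalence and pairwise inequivalent representatives -/

/-! ### Cusp equivalence and pairwise inequivalent representatives -/

omit [NumberField K] in
/-- Cusp equivalence is reflexive. [folklore] -/
theorem CuspRel.refl (v : OVec K) : CuspRel v v :=
  ⟨1, 1, 1, one_ne_zero, one_ne_zero, by simp⟩

omit [NumberField K] in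
/-- Cusp equivalence is symmetric. [folklore] -/
theorem CuspRel.symm {v w : OVec K} (h : CuspRel v w) : CuspRel w v := by
  obtain ⟨γ, x, y, hx, hy, hxy⟩ := h
  refine ⟨γ⁻¹, y, x, hy, hx, ?_⟩
  have h' := congrArg (fun z => ((γ⁻¹ : GL (Fin 2) (𝓞 K)) : Matrix (Fin 2) (Fin 2) (𝓞 K)) *ᵥ z) hxy
  simp only [mulVec_smul, mulVec_mulVec, ← Units.val_mul, inv_mul_cancel, Units.val_one, one_mulVec] at h'
  exact h'.symm

omit [NumberField K] in
/-- Cusp equivalence is transitive. [folklore] -/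
theorem CuspRel.trans {v w z : OVec K} (h : CuspRel v w) (h' : CuspRel w z) : CuspRel v z := by
  obtain ⟨γ, x, y, hx, hy, hxy⟩ := h
  obtain ⟨γ', x', y', hx', hy', hxy'⟩ := h'
  refine ⟨γ * γ', x' * x, y * y', mul_ne_zero hx' hx, mul_ne_zero hy hy', ?_⟩
  rw [mul_smul, hxy, smul_comm, ← mulVec_smul, hxy', mulVec_smul, Units.val_mul, ← mulVec_mulVec, mul_smul]

omit [NumberField K] in
/-- Only `0` is cusp-equivalent to `0`. [folklore] -/
theorem eq_zero_of_cuspRel_zero {v : OVec K} (h : CuspRel 0 v) : v = 0 := by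
  obtain ⟨γ, x, y, hx, hy, hxy⟩ := h
  rw [smul_zero] at hxy
  have h' : (γ : Matrix (Fin 2) (Fin 2) (𝓞 K)) *ᵥ v = 0 := by
    funext i
    have := congrFun hxy i
    simp only [Pi.zero_apply, Pi.smul_apply, smul_eq_mul] at this
    exact (mul_eq_zero.1 this.symm).resolve_left hy
  have := congrArg (fun z => ((γ⁻¹ : GL (Fin 2) (𝓞 K)) : Matrix (Fin 2) (Fin 2) (𝓞 K)) *ᵥ z) h'
  simpa only [mulVec_mulVec, ← Units.val_mul, inv_mul_cancel, Units.val_one, one_mulVec, mulVec_zero] using this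

/-- **Pairwise inequivalent cusp representatives**: a finite set `T` of non-zero integral
vectors, pairwise cusp-inequivalent, such that every non-zero vector is cusp-equivalent to a
member of `T` (one representative per cusp of `GL₂(𝓞_K)`).
[cite: ElstrodtGrunewaldMennicke1998, Ch. 7 §7.2 Thm. 2.4] -/
theorem exists_inequivalent_representatives :
    ∃ T : Finset (OVec K), (∀ u ∈ T, u ≠ 0) ∧ (∀ u ∈ T, ∀ u' ∈ T, CuspRel u u' → u = u') ∧
      ∀ v : OVec K, v ≠ 0 → ∃ u ∈ T, CuspRel v u := by
  classical
  obtain ⟨S, hS, h⟩ := exists_reduced_representatives (K := K)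
  let cuspSetoid : Setoid (OVec K) := ⟨CuspRel, ⟨CuspRel.refl, CuspRel.symm, CuspRel.trans⟩⟩
  let q : OVec K → Quotient cuspSetoid := Quotient.mk _
  refine ⟨S.image fun u => (q u).out, ?_, ?_, ?_⟩
  · intro t ht
    obtain ⟨u, hu, rfl⟩ := Finset.mem_image.1 ht
    intro h0
    have hr : CuspRel (q u).out u := Quotient.mk_out (s := cuspSetoid) u
    rw [h0] at hr
    exact hS u hu (eq_zero_of_cuspRel_zero hr)
  · intro t ht t' ht' htt'
    obtain ⟨u, -, rfl⟩ := Finset.mem_image.1 ht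
    obtain ⟨u', -, rfl⟩ := Finset.mem_image.1 ht'
    have h1 : q (q u).out = q (q u').out := Quotient.sound (s := cuspSetoid) htt'
    have h2 : q u = q u' := by
      have e1 : q (q u).out = q u := Quotient.out_eq (q u)
      have e2 : q (q u').out = q u' := Quotient.out_eq (q u')
      rw [← e1, ← e2, h1]
    rw [h2]
  · intro v hv
    obtain ⟨u, hu, γ, x, y, hx, hy, hxy⟩ := h v hv
    refine ⟨(q u).out, Finset.mem_image.2 ⟨u, hu, rfl⟩, ?_⟩
    have h1 : CuspRel v u := ⟨γ, x, y, hx, hy, hxy⟩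
    exact h1.trans (CuspRel.symm (Quotient.mk_out (s := cuspSetoid) u))

omit [NumberField K] in
/-- Parallel non-zero integral vectors are cusp-equivalent (with `γ = 1`). [folklore] -/
theorem cuspRel_of_det2_eq_zero {v w : OVec K} (hv : v ≠ 0) (hw : w ≠ 0)
    (h : v 0 * w 1 - v 1 * w 0 = 0) : CuspRel v w := by
  have h' : v 0 * w 1 = v 1 * w 0 := sub_eq_zero.1 h
  by_cases h0 : w 0 = 0
  · -- then `v 0 = 0` and the vectors are multiples of `e₁`
    have hw1 : w 1 ≠ 0 := by
      intro h1; apply hw; funext i; fin_cases i; exact h0; exact h1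
    have hv0 : v 0 = 0 := by
      rw [h0, mul_zero] at h'
      exact (mul_eq_zero.1 h').resolve_right hw1
    have hv1 : v 1 ≠ 0 := by
      intro h1; apply hv; funext i; fin_cases i; exact hv0; exact h1
    refine ⟨1, w 1, v 1, hw1, hv1, ?_⟩
    funext i
    fin_cases i
    · simp [hv0, h0]
    · simp
      ring
  · have hv0 : v 0 ≠ 0 := by
      intro hv0
      rw [hv0, zero_mul] at h'
      have hv1 : v 1 = 0 := (mul_eq_zero.1 h'.symm).resolve_right h0
      apply hv; funext i; fin_cases i; exact hv0; exact hv1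
    refine ⟨1, w 0, v 0, h0, hv0, ?_⟩
    funext i
    fin_cases i
    · simp
      ring
    · simp
      linear_combination -h'


/-! ### The normalised forms at a cusp -/

/-- `paramForm` is Hermitian. [folklore] -/
theorem isHermitian_paramForm (q : ℝ × ℂ) : (paramForm q).IsHermitian := by
  rw [paramForm]
  apply Matrix.IsHermitian.ext
  intro i j
  fin_cases i <;> fin_cases j <;> simp [Complex.conj_ofReal]

/-- `paramForm q` has determinant `1` and lies in the cone when `q.1 > 0`. [folklore] -/
theorem paramForm_mem_cone {q : ℝ × ℂ} (hq : 0 < q.1) : paramForm q ∈ cone ∧ hdet (paramForm q) = 1 := by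
  have hd : hdet (paramForm q) = 1 := by
    simp only [hdet, paramForm, of_apply, cons_val', cons_val_zero, cons_val_one, empty_val',
      cons_val_fin_one, Complex.ofReal_re]
    field_simp
    ring
  exact ⟨⟨isHermitian_paramForm q, by simpa [paramForm] using hq, by rw [hd]; exact one_pos⟩, hd⟩

/-- `paramForm` is continuous on `{p ≥ N}` for `N > 0`. [folklore] -/
theorem continuousOn_paramForm {N : ℝ} (hN : 0 < N) : ContinuousOn paramForm {q : ℝ × ℂ | N ≤ q.1} := by
  have h1 : Continuous fun q : ℝ × ℂ => ((q.1 : ℝ) : ℂ) := Complex.continuous_ofReal.comp continuous_fst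
  have h2 : Continuous fun q : ℝ × ℂ => q.2 := continuous_snd
  have h3 : Continuous fun q : ℝ × ℂ => conj q.2 := Complex.continuous_conj.comp continuous_snd
  have h4 : ContinuousOn (fun q : ℝ × ℂ => ((((1 + Complex.normSq q.2) / q.1 : ℝ)) : ℂ)) {q : ℝ × ℂ | N ≤ q.1} := by
    refine Complex.continuous_ofReal.comp_continuousOn ?_
    refine ((continuous_const.add (Complex.continuous_normSq.comp continuous_snd)).continuousOn).div
      continuous_fst.continuousOn fun q hq => ?_
    exact (lt_of_lt_of_le hN hq).ne'
  refine continuousOn_pi.2 fun i => continuousOn_pi.2 fun j => ?_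
  fin_cases i <;> fin_cases j
  · exact h1.continuousOn
  · exact h2.continuousOn
  · exact h3.continuousOn
  · exact h4

/-- **The normalised forms with `p ∈ [N, C N]`, `|z| ≤ R` form a compact subset of the cone.**
[cite: ElstrodtGrunewaldMennicke1998, Ch. 7 §7.3] -/
theorem isCompact_paramForm_image {N C R : ℝ} (hN : 0 < N) :
    IsCompact (paramForm '' (Set.Icc N (C * N) ×ˢ Metric.closedBall (0 : ℂ) R)) := by
  refine ((isCompact_Icc.prod (isCompact_closedBall (0 : ℂ) R)).image_of_continuousOn ?_)
  exact (continuousOn_paramForm hN).mono fun q hq => hq.1.1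

/-- A form of the cone with `hdet = 1` is the `paramForm` of its corner and its off-diagonal
entry. [folklore] -/
theorem eq_paramForm {M : Mat} (hM : M ∈ cone) (hd : hdet M = 1) :
    M = paramForm ((M 0 0).re, M 0 1) := by
  obtain ⟨hherm, hp, -⟩ := hM
  have h00 := im_apply_self_of_isHermitian hherm 0
  have h11 := im_apply_self_of_isHermitian hherm 1
  have h10 := apply_one_zero_of_isHermitian hherm
  have hr : (M 1 1).re = (1 + Complex.normSq (M 0 1)) / (M 0 0).re := by
    rw [hdet] at hd
    field_simp
    linarith
  ext i j
  fin_cases i <;> fin_cases j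
  · change M 0 0 = ((M 0 0).re : ℂ)
    apply Complex.ext <;> simp [h00]
  · rfl
  · exact h10
  · change M 1 1 = (((1 + Complex.normSq (M 0 1)) / (M 0 0).re : ℝ) : ℂ)
    rw [← hr]
    apply Complex.ext <;> simp [h11]

/-! ### The fundamental set -/

/-- **A compact fundamental set for the thick part.**  There is a compact `F ⊆ 𝒫` such that
every `H ∈ 𝒫` at which all cusps have depth `≥ 1` satisfies `t · (γ • H) ∈ F` for some
`γ ∈ GL₂(𝓞_K)` and `t > 0`. [cite: ElstrodtGrunewaldMennicke1998, Ch. 7 §7.3] -/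
theorem exists_compact_fundamental [IsTotallyComplex K] (hK : Module.finrank ℚ K = 2) :
    ∃ F : Set Mat, IsCompact F ∧ F ⊆ cone ∧
      ∀ H ∈ cone, (∀ v : OVec K, v ≠ 0 → 1 ≤ depth σ v H) →
        ∃ (γ : GL (Fin 2) (𝓞 K)) (t : ℝ), 0 < t ∧ t • act (toGL σ γ) H ∈ F := by
  classical
  obtain ⟨C, hC, hdir⟩ := exists_depth_le (K := K) σ
  obtain ⟨T, hT0, -, hT⟩ := exists_inequivalent_representatives (K := K)
  obtain ⟨ω, hω⟩ := ImaginaryQuadratic.exists_im_ne_zero (K := K) σ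
  set ρ : ℝ := (1 + ‖σ (ω : K)‖) / 2 with hρ
  -- the compact pieces
  let Nu : OVec K → ℝ := fun u => (Ideal.absNorm (idealOf u) : ℝ)
  let Ku : OVec K → Set Mat := fun u =>
    paramForm '' (Set.Icc (Nu u) (C * Nu u) ×ˢ Metric.closedBall (0 : ℂ) (ρ * C * Nu u))
  let Fu : {u // u ∈ T} → Set Mat := fun u => act (cuspGL σ (hT0 u.1 u.2)) '' Ku u.1
  refine ⟨⋃ u : {u // u ∈ T}, Fu u, isCompact_iUnion fun u => ?_, ?_, ?_⟩
  · -- compactness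
    have hN : 0 < Nu u.1 := by
      change (0 : ℝ) < (Ideal.absNorm (idealOf u.1) : ℝ)
      exact_mod_cast absNorm_idealOf_pos (hT0 u.1 u.2)
    exact (isCompact_paramForm_image hN).image (continuous_act _)
  · -- inside the cone
    rintro M hM
    obtain ⟨u, hM⟩ := Set.mem_iUnion.1 hM
    obtain ⟨M', ⟨q, hq, rfl⟩, rfl⟩ := hM
    have hN : 0 < Nu u.1 := by
      change (0 : ℝ) < (Ideal.absNorm (idealOf u.1) : ℝ)
      exact_mod_cast absNorm_idealOf_pos (hT0 u.1 u.2)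
    exact act_mem_cone _ (paramForm_mem_cone (lt_of_lt_of_le hN hq.1.1)).1
  · -- the reduction
    intro H hH hthick
    obtain ⟨v, hv, hvC⟩ := hdir H hH
    obtain ⟨u, huT, γ, x, y, hx, hy, hxy⟩ := hT v hv
    have hu : u ≠ 0 := hT0 u huT
    -- `depth_u (γ⁻¹ • H) = depth_v H ∈ [1, C]`
    have hγu : (γ : Matrix (Fin 2) (Fin 2) (𝓞 K)) *ᵥ u ≠ 0 := by
      intro h0
      have := congrArg (fun z => ((γ⁻¹ : GL (Fin 2) (𝓞 K)) : Matrix (Fin 2) (Fin 2) (𝓞 K)) *ᵥ z) h0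
      simp only [mulVec_mulVec, ← Units.val_mul, inv_mul_cancel, Units.val_one, one_mulVec, mulVec_zero] at this
      exact hu this
    have hdepth_eq : depth σ ((γ : Matrix (Fin 2) (Fin 2) (𝓞 K)) *ᵥ u) H = depth σ v H := by
      rw [← depth_cmul σ hK hy ((γ : Matrix (Fin 2) (Fin 2) (𝓞 K)) *ᵥ u) H, ← hxy, depth_cmul σ hK hx]
    set H₁ : Mat := act (toGL σ γ)⁻¹ H with hH₁
    have hH₁c : H₁ ∈ cone := act_mem_cone _ hH
    have hd₁ : depth σ u H₁ = depth σ v H := by rw [hH₁, depth_act_inv σ hK γ u hH.1, hdepth_eq]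
    have hd₁l : 1 ≤ depth σ u H₁ := by rw [hd₁, ← hdepth_eq]; exact hthick _ hγu
    have hd₁u : depth σ u H₁ ≤ C := by rw [hd₁]; exact hvC
    -- translate the horizontal coordinate
    obtain ⟨x₀, hx₀⟩ := ImaginaryQuadratic.exists_norm_sub_le σ hω (hcoord σ hu H₁)
    set H₂ : Mat := act (toGL σ (transl u x₀)) H₁ with hH₂
    have hH₂c : H₂ ∈ cone := act_mem_cone _ hH₁c
    have hd₂ : depth σ u H₂ = depth σ u H₁ := depth_act_transl σ hK x₀ hH₁c.1
    have hw₂ : ‖hcoord σ hu H₂‖ ≤ ρ := by rw [hH₂, hcoord_act_transl σ hu x₀ hH₁c]; exact hx₀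
    have hH₂γ : H₂ = act (toGL σ (transl u x₀ * γ⁻¹)) H := by
      rw [hH₂, hH₁, map_mul, act_mul, map_inv]
    -- normalise
    set M : Mat := cuspForm σ hu H₂ with hMdef
    have hMc : M ∈ cone := act_mem_cone _ hH₂c
    have hrM : 0 < rdet M := rdet_pos hMc
    set t : ℝ := (rdet M)⁻¹ with ht
    have ht0 : 0 < t := inv_pos.2 hrM
    refine ⟨transl u x₀ * γ⁻¹, t, ht0, Set.mem_iUnion.2 ⟨⟨u, huT⟩, ?_⟩⟩
    -- `t • H₂ = g • (t • M)` with `t • M` a normalised form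
    have hgM : act (cuspGL σ hu) M = H₂ := by
      rw [hMdef, cuspForm, ← act_mul, mul_inv_cancel, act_one]
    refine ⟨t • M, ?_, by rw [act_smul, hgM, hH₂γ]⟩
    have htMc : t • M ∈ cone := smul_mem_cone ht0 hMc
    have hdet1 : hdet (t • M) = 1 := by
      rw [hdet_smul, ← rdet_sq hMc, ht, inv_pow, inv_mul_cancel₀ (pow_ne_zero 2 hrM.ne')]
    refine ⟨(((t • M) 0 0).re, (t • M) 0 1), ?_, (eq_paramForm htMc hdet1).symm⟩
    -- the bounds
    have hN : (0 : ℝ) < Nu u := by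
      change (0 : ℝ) < (Ideal.absNorm (idealOf u) : ℝ)
      exact_mod_cast absNorm_idealOf_pos hu
    have hq : qf H₂ (emb σ u) = (M 0 0).re := (re_cuspForm_zero_zero σ hu H₂).symm
    have hrd : rdet M = rdet H₂ := by
      rw [hMdef, cuspForm, rdet_act _ hH₂c.1]
      have : ‖(((cuspGL σ hu)⁻¹ : GL (Fin 2) ℂ) : Mat).det‖ = 1 := by
        rw [coe_cuspGL_inv]
        have h := (compl_spec hu).2.2
        rw [det_fin_two_of]
        have : σ (compl hu).2 * σ (u 0 : K) - -σ (compl hu).1 * -σ (u 1 : K) =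
            σ ((u 0 : K) * (compl hu).2 - (u 1 : K) * (compl hu).1) := by
          rw [map_sub, map_mul, map_mul]; ring
        rw [this, h, map_one, norm_one]
      rw [this, div_one]
    have hdepth : depth σ u H₂ = (M 0 0).re / (Nu u * rdet M) := by
      rw [depth, hq, hrd]
    have hP : ((t • M) 0 0).re = Nu u * depth σ u H₂ := by
      rw [Matrix.smul_apply, Complex.real_smul, Complex.re_ofReal_mul, hdepth, ht]
      field_simp
    have hM00 : M 0 0 = (((M 0 0).re : ℝ) : ℂ) := by
      rw [hMdef, cuspForm_zero_zero σ hu hH₂c.1, Complex.ofReal_re]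
    have h00 : M 0 0 ≠ 0 := by rw [hMdef]; exact cuspForm_zero_zero_ne_zero σ hu hH₂c
    have hZ : (t • M) 0 1 = hcoord σ hu H₂ * ((((t • M) 0 0).re : ℝ) : ℂ) := by
      have hh : hcoord σ hu H₂ = M 0 1 / M 0 0 := rfl
      rw [hh, Matrix.smul_apply, Matrix.smul_apply, Complex.real_smul, Complex.real_smul, Complex.re_ofReal_mul,
        Complex.ofReal_mul, ← hM00]
      field_simp
    refine ⟨⟨?_, ?_⟩, ?_⟩
    · rw [hP, hd₂]
      nlinarith
    · rw [hP, hd₂, mul_comm]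
      exact mul_le_mul_of_nonneg_right hd₁u hN.le
    · rw [Metric.mem_closedBall, dist_zero_right, hZ, norm_mul, Complex.norm_real, Real.norm_eq_abs, hP, hd₂,
        abs_of_nonneg (mul_nonneg hN.le (depth_nonneg σ hH₁c))]
      calc ‖hcoord σ hu H₂‖ * (Nu u * depth σ u H₁) ≤ ρ * (Nu u * C) := by
            refine mul_le_mul hw₂ (mul_le_mul_of_nonneg_left hd₁u hN.le) (by positivity) (by positivity)
        _ = ρ * C * Nu u := by ring

end BianchiCusp

end Literature.NumberTheory.Automorphic
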